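import Summits.QuantumFields.BalabanUV.T4Continuum.Support.NE3CurlPairedResidualEnd
import Summits.QuantumFields.BalabanUV.T4Continuum.Support.SpreadLift
import Summits.QuantumFields.BalabanUV.T4Continuum.Support.NE3LiftDefectCorrection
import Summits.QuantumFields.BalabanUV.T4Continuum.Support.AveragingDeficitFermat
import Summits.QuantumFields.BalabanUV.T4Continuum.Support.NE3SpreadLiftCurl
import HarnessLib

/-!
# T⁴ programme, node NE3 — row E-RES♯, sub-row R♯5, file (5c): THE EXACT LIFT IS `SpreadLift.spreadInverse`; (RES♯)
# `CurlPairedResidual` BY NAME for the block average of the run-B minimiser — modulo the curl bound of `spreadLift` (§3),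
# and WITHOUT hypotheses beyond the setting via leaf-01-g4's R♯3b `NE3SpreadLiftCurl` (§4)

NE3 formalisation swarm, LEAF PROVER 02 (unit `b2b-balaban-t4-ne3-formalise-leaf-02`, gen 4; cell `pub-balaban`); owner CUT «E-RES♯
INTO ROWS» (journal 2026-08-20T14:09Z), row (R♯5); SHAPE `t4/formal/NE3/Statements/E-RES-R5-SHAPE-v1.md`; file (5b) =
`NE3CurlPairedResidualEnd` (socket from the EXISTENCE of an exact curl-controlled lift).  THIS FILE discharges the existence with
the tree's EXACT one-level right inverse `SpreadLift.spreadInverse hL hV ha h512 hVa` (= `spreadLift ∘ invData`, leaf-01 gen 3,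
S6-Y7 (c)): push-EXACT (`pushDir_spreadInverse`), skew (`isSkewDir_spreadInverse`), periodic (`isPeriodicDir_spreadInverse`),
`ℓ¹`-bounded (`dirL1_spreadInverse_le`) — all BY NAME — and REDUCES its curl bound to that of the plain replication `spreadLift`
on the bondwise-inverted datum `invData φ` (R♯3b, leaf-01-g4's `NE3SpreadLiftCurl.sqrt_curlSq_spreadLift_le` ✓: taken in §2–§3 as the
HYPOTHESIS `hR3b` with abstract constants `k₁, k₂`, and `curlL1_spreadLift_le` as `hR3bL1` with `k₄`; DISCHARGED by name in §4), via
`‖invData φ − φ‖ ≤ 128dL²a‖φ‖` pointwise (`SpreadLiftMap.norm_spreadInv_le`), Minkowski (`NE3LiftDefectCorrection.sqrt_curlSq_add_le`)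
and the crude periodic bound `AveragingDeficitDualResidual.curlSq_le_periodic` at the unitary base `cavg L V`
(`AveragingDeficitTwoLevelPrep.cavg_isUnitaryCfg`).

CONTENT ([folklore]; 0 `def`, 0 sorry):
* §1 pointwise-to-sum bookkeeping (`dirSq_le_of_pointwise`, `sqrt_dirSq_le_of_pointwise`, `dirL1_le_of_pointwise`) and the datum
  `invData`: `isPeriodicDir_invData`, `norm_invData_sub_le`, `norm_invData_le`;
* §2 **`spreadInverse_lift`** — at ONE level (`V` unitary `L·M`-periodic `a`-small, `512(d+1)(d+4)L²a ≤ 1`, `φ` skew `M`-periodic),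
  under `hR3b`∕`hR3bL1` for `spreadLift` at `V`: the six properties of `ψ := spreadInverse φ` with
  `c₁ = k₁`, `c₂ = k₁·√(8·#Plane d)·128·d·L² + 2·k₂`, `c₃ = 2·L^{d−1}`, `c₄ = 2·k₄`;
* §3 `small512_of_levelSmall`; **`curlPairedResidual_spreadInverse`** — (RES♯) `CurlPairedResidual L (j+1) (cavg L U_B) T r (periodBox (N·L^{j+1}))` in the
  setting of (5b) (`IsMinimiser (sfClass L N ε) L N (j+2) V U_B`, `Regular d L N b g (j+2) U_B`, `0 ≤ b < ε`,
  `LevelSmall d L (j+1) (ε∕(L^{j+2})²)`) MODULO ONLY `hR3b`∕`hR3bL1` at `V := U_B`, `a := b∕(L^{j+2})²`, `M := N·L^{j+1}`; the smallness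
  `512(d+1)(d+4)L²a ≤ 1` is DERIVED (`LevelSmall.two`, `smallness_of_twoLevelSmall`, `small512_of_liftSmall`);
* §4 **`curlPairedResidual_regular`** — (RES♯) in the same setting with NO lift hypothesis (`d ≥ 2`): `hR3b`∕`hR3bL1` DISCHARGED by
  leaf-01-g4's landed R♯3b `NE3SpreadLiftCurl.sqrt_curlSq_spreadLift_le` (`k₁ = √(L^{d−2})`, `k₂ = 2048(d+4)²L²√(d·L^d)`) and
  `NE3SpreadLiftCurl.curlL1_spreadLift_le` (`k₄ = 8dL^d`) BY NAME.

HONEST FRAMING.  Kinematics of one averaging step plus the assembly of (5b); §4 has NO hypothesis beyond the (5b) setting (minimiser,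
`Regular`, `LevelSmall`, `0 ≤ b < ε`, `d ≥ 2`, `L, N ≥ 1`); nothing printed is a hypothesis (context: [Balaban1985Averaging] (42) p.23, (139)–(147)
p.39–40; [Balaban1985Variational] (26)–(27) p.282); (RES♯) NOT proved unconditionally, T-E_w♯, NE3 NOT proved; spine PROVED 0∕9;
finite T⁴ rung (B)+1 — NOT infinite volume, NOT mass gap, NOT `BetaPertH`, NOT Clay.  PLACEMENT: `Summits/QuantumFields/BalabanUV/`.
HONEST DEPENDENCY: continuum YM on T⁴ ⇐ BetaPertH ∧ nine spine estimates (0/9 proved); BetaPertH ⇐ (D1) ∧ (D4) ∧ CAP+tail;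
G-an2-4 gates asym, D1 and NE2/3/4.
-/

set_option autoImplicit false

open scoped BigOperators Matrix Matrix.Norms.L2Operator
open NormedSpace Finset

namespace Summit.QuantumFields.BalabanUV.T4Continuum.NE3CurlPairedResidualSpread

open Literature.MathematicalPhysics.QuantumFieldTheory.Balaban1983to89
open B7Prop1Explicit B7Prop2Explicit MatrixLog UnitaryModel
open T4AveragingDeficitWall hiding Site Plane Plaq Bond
open T4AveragingDeficitWallBoundary (IsPeriodicCfg periodBox blockSites_periodBox)
open AveragingDeficitPeriodicCounting (IsPeriodicDir)
open AveragingDeficitDerivWallProof (wallConst)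
open AveragingDeficitResidualPairing (pushDir)
open AveragingDeficitDualResidual (curlSq_le_periodic)
open AveragingDeficitChartCalculus (cavg)
open AveragingDeficitTwoLevelPrep (cavg_isUnitaryCfg smallness_of_twoLevelSmall)
open AveragingDeficitFaceLift (liftSmall)
open AveragingDeficitFermat (small512_of_liftSmall)
open AveragingDeficitMultiLevelPrep (LevelSmall TangentIter)
open MinimalActionSandwich (IsMinimiser)
open MinimalActionRate (Regular sfClass)
open NE3EnergyWeightedShapes (CurlPairedResidual)
open NE3EnergyHessContTwoTerm (curlSq_nonneg dirSq_nonneg)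
open NE3LiftDefectCorrection (sqrt_curlSq_add_le)
open SpreadLiftDirection (spreadLift)
open SpreadLiftMap (norm_spreadInv_le)
open SpreadLift (spreadInverse invData spreadInverse_apply pushDir_spreadInverse isSkewDir_spreadInverse isPeriodicDir_spreadInverse
  dirL1_spreadInverse_le invData_shift small128_of_small512 loopRad_le loopBound_of_smallField)
open NE3CurlPairedResidualEnd (curlPairedResidual_of_exists_lift)
open NE3SpreadLiftCurl (sqrt_curlSq_spreadLift_le curlL1_spreadLift_le)

noncomputable section

variable {d : ℕ} {n : Type*} [Fintype n] [DecidableEq n]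

/-! ## §1 Pointwise-to-sum bookkeeping; the bondwise-inverted datum -/

/-- A pointwise bound `‖Z x κ‖ ≤ c‖φ x κ‖` sums to `dirSq Z F ≤ c²·dirSq φ F`. [folklore] -/
theorem dirSq_le_of_pointwise {Z φ : Site d → Fin d → Matrix n n ℂ} {c : ℝ}
    (h : ∀ (x : Site d) (κ : Fin d), ‖Z x κ‖ ≤ c * ‖φ x κ‖) (F : Finset (Site d)) : dirSq Z F ≤ c ^ 2 * dirSq φ F := by
  unfold T4AveragingDeficitWall.dirSq
  rw [Finset.mul_sum]
  refine Finset.sum_le_sum fun x _ => ?_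
  rw [Finset.mul_sum]
  refine Finset.sum_le_sum fun κ _ => ?_
  calc ‖Z x κ‖ ^ 2 ≤ (c * ‖φ x κ‖) ^ 2 := pow_le_pow_left₀ (norm_nonneg _) (h x κ) 2
    _ = c ^ 2 * ‖φ x κ‖ ^ 2 := by ring

/-- … hence `√dirSq Z F ≤ c·√dirSq φ F`. [folklore] -/
theorem sqrt_dirSq_le_of_pointwise {Z φ : Site d → Fin d → Matrix n n ℂ} {c : ℝ} (hc : 0 ≤ c)
    (h : ∀ (x : Site d) (κ : Fin d), ‖Z x κ‖ ≤ c * ‖φ x κ‖) (F : Finset (Site d)) :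
    Real.sqrt (dirSq Z F) ≤ c * Real.sqrt (dirSq φ F) := by
  calc Real.sqrt (dirSq Z F) ≤ Real.sqrt (c ^ 2 * dirSq φ F) := Real.sqrt_le_sqrt (dirSq_le_of_pointwise h F)
    _ = c * Real.sqrt (dirSq φ F) := by rw [Real.sqrt_mul (sq_nonneg c), Real.sqrt_sq hc]

/-- A pointwise bound sums to `dirL1 Z F ≤ c·dirL1 φ F`. [folklore] -/
theorem dirL1_le_of_pointwise {Z φ : Site d → Fin d → Matrix n n ℂ} {c : ℝ}
    (h : ∀ (x : Site d) (κ : Fin d), ‖Z x κ‖ ≤ c * ‖φ x κ‖) (F : Finset (Site d)) : dirL1 Z F ≤ c * dirL1 φ F := by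
  unfold T4AveragingDeficitWall.dirL1
  rw [Finset.mul_sum]
  refine Finset.sum_le_sum fun x _ => ?_
  rw [Finset.mul_sum]
  exact Finset.sum_le_sum fun κ _ => h x κ

section OneLevel

variable [Nonempty n] {L : ℕ} (hL : 1 ≤ L) {V : Site d → Fin d → (Matrix n n ℂ)ˣ} (hV : IsUnitaryCfg V) {a : ℝ}
  (ha : 0 ≤ a) (h512 : 512 * (d + 1) * (d + 4) * (L : ℝ) ^ 2 * a ≤ 1) (hVa : SmallField V a)

/-- The bondwise-inverted datum of an `M`-periodic datum is `M`-periodic (for `L·M`-periodic `V`). [folklore] -/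
theorem isPeriodicDir_invData {M : ℕ} (hVP : IsPeriodicCfg V ((L : ℤ) * M)) {φ : Site d → Fin d → Matrix n n ℂ}
    (hφ : IsPeriodicDir φ (M : ℤ)) : IsPeriodicDir (invData hL hV ha h512 hVa φ) (M : ℤ) := by
  intro y j κ
  have hVv : ∀ (x : Site d) (μ : Fin d), V (x + (L : ℤ) • ((M : ℤ) • e j)) μ = V x μ := fun x μ => by
    rw [smul_smul]; exact hVP x j μ
  exact invData_shift hL hV ha h512 hVa y ((M : ℤ) • e j) κ hVv (hφ y j κ)

/-- `‖invData φ (y,κ) − φ(y,κ)‖ ≤ 128dL²a·‖φ(y,κ)‖` — the inverse-side counterpart, with the tree's constant, of the near-identity of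
the linearised averaging (context only: [Balaban1985Averaging] (139)–(147) p.39–40, a KIND locator, not a quotation). [folklore] -/
theorem norm_invData_sub_le (φ : Site d → Fin d → Matrix n n ℂ) (y : Site d) (κ : Fin d) :
    ‖invData hL hV ha h512 hVa φ y κ - φ y κ‖ ≤ 128 * (d * (L : ℝ) ^ 2 * a) * ‖φ y κ‖ := by
  simp only [invData]
  exact (norm_spreadInv_le hL hV ha hVa (small128_of_small512 ha h512) y κ (loopRad_le h512)
    (loopBound_of_smallField hL hV ha h512 hVa y κ) (φ y κ)).2

/-- `‖invData φ (y,κ)‖ ≤ (1 + 128dL²a)·‖φ(y,κ)‖ ≤ 2‖φ(y,κ)‖`. [folklore] -/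
theorem norm_invData_le (φ : Site d → Fin d → Matrix n n ℂ) (y : Site d) (κ : Fin d) :
    ‖invData hL hV ha h512 hVa φ y κ‖ ≤ 2 * ‖φ y κ‖ := by
  have h1 := (norm_spreadInv_le hL hV ha hVa (small128_of_small512 ha h512) y κ (loopRad_le h512)
    (loopBound_of_smallField hL hV ha h512 hVa y κ) (φ y κ)).1
  have h128 := small128_of_small512 (d := d) (L := L) ha h512
  simp only [invData]
  refine h1.trans ?_
  have : (1 + 128 * (d * (L : ℝ) ^ 2 * a)) ≤ 2 := by linarith
  exact mul_le_mul_of_nonneg_right this (norm_nonneg _)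

/-! ## §2 The six properties of the exact lift `spreadInverse φ`, modulo the curl bound of `spreadLift` (R♯3b) -/

/-- **THE EXACT LIFT `Q_V φ = spreadInverse φ` AND ITS NORMS, MODULO (R♯3b).**  One level: `V` unitary, `L·M`-periodic, `a`-small with
`512(d+1)(d+4)L²a ≤ 1`, `M ≥ 1`; HYPOTHESES `hR3b` (the curl of the plain covariant replication `spreadLift L V φ'` of every
`M`-periodic datum `φ'`: `√curlSq ≤ k₁·√curlSq (cavg L V) φ' + k₂·a·√dirSq φ'` over one period) and `hR3bL1` (`curlL1 ≤ k₄·dirL1 φ'`).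
THEN for every skew `M`-periodic `φ`, `ψ := spreadInverse φ` is skew, `L·M`-periodic, push-EXACT, and
`√curlSq V ψ ≤ k₁·√curlSq (cavg L V) φ + (k₁·√(8·#Plane)·128dL² + 2k₂)·a·√dirSq φ`, `dirL1 ψ ≤ 2L^{d−1}·dirL1 φ`,
`curlL1 V ψ ≤ 2k₄·dirL1 φ`. [folklore] -/
theorem spreadInverse_lift {M : ℕ} (hM : 1 ≤ M) (hVP : IsPeriodicCfg V ((L : ℤ) * M)) {k₁ k₂ k₄ : ℝ} (hk₁ : 0 ≤ k₁)
    (hk₂ : 0 ≤ k₂) (hk₄ : 0 ≤ k₄)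
    (hR3b : ∀ φ' : Site d → Fin d → Matrix n n ℂ, IsPeriodicDir φ' (M : ℤ) →
      Real.sqrt (curlSq V (spreadLift L V φ') (periodBox (L * M)))
        ≤ k₁ * Real.sqrt (curlSq (cavg L V) φ' (periodBox M)) + k₂ * a * Real.sqrt (dirSq φ' (periodBox M)))
    (hR3bL1 : ∀ φ' : Site d → Fin d → Matrix n n ℂ, IsPeriodicDir φ' (M : ℤ) →
      curlL1 V (spreadLift L V φ') (periodBox (L * M)) ≤ k₄ * dirL1 φ' (periodBox M))
    {φ : Site d → Fin d → Matrix n n ℂ} (hφs : IsSkewDir φ) (hφ : IsPeriodicDir φ (M : ℤ)) :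
    IsSkewDir (spreadInverse hL hV ha h512 hVa φ) ∧ IsPeriodicDir (spreadInverse hL hV ha h512 hVa φ) ((L : ℤ) * M)
      ∧ (∀ (y : Site d) (κ : Fin d), pushDir L V (spreadInverse hL hV ha h512 hVa φ) ((L : ℤ) • y) κ = φ y κ)
      ∧ Real.sqrt (curlSq V (spreadInverse hL hV ha h512 hVa φ) (periodBox (L * M)))
          ≤ k₁ * Real.sqrt (curlSq (cavg L V) φ (periodBox M))
            + (k₁ * Real.sqrt (8 * Fintype.card (T4AveragingDeficitWall.Plane d)) * (128 * (d * (L : ℝ) ^ 2)) + 2 * k₂) * a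
              * Real.sqrt (dirSq φ (periodBox M))
      ∧ dirL1 (spreadInverse hL hV ha h512 hVa φ) (periodBox (L * M)) ≤ 2 * (L : ℝ) ^ (d - 1) * dirL1 φ (periodBox M)
      ∧ curlL1 V (spreadInverse hL hV ha h512 hVa φ) (periodBox (L * M)) ≤ 2 * k₄ * dirL1 φ (periodBox M) := by
  have h128 := small128_of_small512 (d := d) (L := L) ha h512
  have hθ : 0 ≤ 128 * (d * (L : ℝ) ^ 2 * a) := by positivity
  set φ' : Site d → Fin d → Matrix n n ℂ := invData hL hV ha h512 hVa φ with hφ'_def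
  have hφ'P : IsPeriodicDir φ' (M : ℤ) := isPeriodicDir_invData hL hV ha h512 hVa hVP hφ
  -- the datum and its defect, pointwise and in the sums
  have hsub : ∀ (y : Site d) (κ : Fin d), ‖(φ' - φ) y κ‖ ≤ 128 * (d * (L : ℝ) ^ 2 * a) * ‖φ y κ‖ := fun y κ => by
    rw [Pi.sub_apply, Pi.sub_apply]; exact norm_invData_sub_le hL hV ha h512 hVa φ y κ
  have hle2 : ∀ (y : Site d) (κ : Fin d), ‖φ' y κ‖ ≤ 2 * ‖φ y κ‖ := fun y κ => norm_invData_le hL hV ha h512 hVa φ y κ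
  have hδP : IsPeriodicDir (φ' - φ) (M : ℤ) := fun x κ μ => by rw [Pi.sub_apply, Pi.sub_apply, hφ'P x κ μ, hφ x κ μ]; rfl
  have hV₁ : IsUnitaryCfg (cavg L V) := cavg_isUnitaryCfg hL hV ha h512 hVa
  -- the curl of the datum: Minkowski + the crude periodic bound on the defect
  have hcurlφ' : Real.sqrt (curlSq (cavg L V) φ' (periodBox M))
      ≤ Real.sqrt (curlSq (cavg L V) φ (periodBox M))
        + Real.sqrt (8 * Fintype.card (T4AveragingDeficitWall.Plane d)) * (128 * (d * (L : ℝ) ^ 2 * a))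
          * Real.sqrt (dirSq φ (periodBox M)) := by
    have hdec : φ' = φ + (φ' - φ) := by abel
    have hmink := sqrt_curlSq_add_le (cavg L V) φ (φ' - φ) (periodBox M)
    rw [← hdec] at hmink
    refine hmink.trans (add_le_add le_rfl ?_)
    have hcr := curlSq_le_periodic hV₁ hM hδP
    calc Real.sqrt (curlSq (cavg L V) (φ' - φ) (periodBox M))
        ≤ Real.sqrt (8 * Fintype.card (T4AveragingDeficitWall.Plane d) * dirSq (φ' - φ) (periodBox M)) :=
          Real.sqrt_le_sqrt hcr
      _ = Real.sqrt (8 * Fintype.card (T4AveragingDeficitWall.Plane d)) * Real.sqrt (dirSq (φ' - φ) (periodBox M)) :=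
          Real.sqrt_mul (by positivity) _
      _ ≤ Real.sqrt (8 * Fintype.card (T4AveragingDeficitWall.Plane d))
            * (128 * (d * (L : ℝ) ^ 2 * a) * Real.sqrt (dirSq φ (periodBox M))) :=
          mul_le_mul_of_nonneg_left (sqrt_dirSq_le_of_pointwise hθ hsub _) (Real.sqrt_nonneg _)
      _ = _ := by ring
  have hdirφ' : Real.sqrt (dirSq φ' (periodBox M)) ≤ 2 * Real.sqrt (dirSq φ (periodBox M)) :=
    sqrt_dirSq_le_of_pointwise (by norm_num) hle2 _
  have hdirL1φ' : dirL1 φ' (periodBox M) ≤ 2 * dirL1 φ (periodBox M) := dirL1_le_of_pointwise hle2 _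
  refine ⟨isSkewDir_spreadInverse hL hV ha h512 hVa hφs, isPeriodicDir_spreadInverse hL hV ha h512 hVa hVP hφ,
    fun y κ => pushDir_spreadInverse hL hV ha h512 hVa φ y κ, ?_, ?_, ?_⟩
  · -- curl
    rw [spreadInverse_apply]
    have h := hR3b φ' hφ'P
    refine h.trans ?_
    have hs0 : 0 ≤ Real.sqrt (dirSq φ (periodBox M)) := Real.sqrt_nonneg _
    have hc0 : 0 ≤ Real.sqrt (curlSq (cavg L V) φ (periodBox M)) := Real.sqrt_nonneg _
    have t1 := mul_le_mul_of_nonneg_left hcurlφ' hk₁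
    have t2 := mul_le_mul_of_nonneg_left hdirφ' (mul_nonneg hk₂ ha)
    have hP0 : 0 ≤ Real.sqrt (8 * Fintype.card (T4AveragingDeficitWall.Plane d)) := Real.sqrt_nonneg _
    nlinarith
  · -- ℓ¹ mass
    have h := dirL1_spreadInverse_le hL hV ha h512 hVa φ M
    refine h.trans ?_
    have hsum : ∑ y ∈ periodBox M, ∑ i : Fin d, ‖φ y i‖ = dirL1 φ (periodBox M) := rfl
    rw [hsum]
    have hL1 : 0 ≤ (L : ℝ) ^ (d - 1) * dirL1 φ (periodBox M) :=
      mul_nonneg (by positivity) (AveragingDeficitDerivCore.dirL1_nonneg _ _)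
    have : (1 + 128 * (d * (L : ℝ) ^ 2 * a)) ≤ 2 := by linarith
    calc (1 + 128 * (d * (L : ℝ) ^ 2 * a)) * (L : ℝ) ^ (d - 1) * ∑ y ∈ periodBox M, ∑ i : Fin d, ‖φ y i‖
        = (1 + 128 * (d * (L : ℝ) ^ 2 * a)) * ((L : ℝ) ^ (d - 1) * dirL1 φ (periodBox M)) := by rw [hsum]; ring
      _ ≤ 2 * ((L : ℝ) ^ (d - 1) * dirL1 φ (periodBox M)) := mul_le_mul_of_nonneg_right this hL1
      _ = _ := by ring
  · -- curl ℓ¹ mass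
    rw [spreadInverse_apply]
    refine (hR3bL1 φ' hφ'P).trans ?_
    have := mul_le_mul_of_nonneg_left hdirL1φ' hk₄
    linarith

end OneLevel

/-! ## §3 (RES♯) by name, modulo only the curl bound of `spreadLift` at `U_B` -/

/-- The standard one-step smallness `512(d+1)(d+4)L²·a ≤ 1` of the plaquette radius `a = b∕(L^{j+2})²` of run B, from the multi-level
smallness `LevelSmall d L (j+1) (ε∕(L^{j+2})²)` and `0 ≤ b < ε` (`LevelSmall.two`, `smallness_of_twoLevelSmall`, `small512_of_liftSmall`).
[folklore] -/
theorem small512_of_levelSmall {L : ℕ} (hL : 1 ≤ L) (j : ℕ) {ε b : ℝ} (hb : 0 ≤ b) (hbε : b < ε)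
    (hsmall : LevelSmall d L (j + 1) (ε / ((L : ℝ) ^ (j + 2)) ^ 2)) :
    512 * (d + 1) * (d + 4) * (L : ℝ) ^ 2 * (b / ((L : ℝ) ^ (j + 2)) ^ 2) ≤ 1 := by
  have hL0 : (0 : ℝ) < L := by exact_mod_cast hL
  have hP : (0 : ℝ) < ((L : ℝ) ^ (j + 2)) ^ 2 := pow_pos (pow_pos hL0 _) 2
  have ha : 0 ≤ b / ((L : ℝ) ^ (j + 2)) ^ 2 := div_nonneg hb hP.le
  have haε : b / ((L : ℝ) ^ (j + 2)) ^ 2 ≤ ε / ((L : ℝ) ^ (j + 2)) ^ 2 := (div_lt_div_of_pos_right hbε hP).le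
  have h1 := (smallness_of_twoLevelSmall (d := d) hL (ha.trans haε) hsmall.two).1
  have h0 : 0 ≤ liftSmall d L := by unfold liftSmall; positivity
  exact small512_of_liftSmall hL ha ((mul_le_mul_of_nonneg_left haε h0).trans h1)

/-- **(RES♯) `CurlPairedResidual` BY NAME, MODULO ONLY (R♯3b) FOR `spreadLift` AT `U_B`.**  Setting of (5b): levels `j+1`∕`j+2`,
`U_B` a minimiser of `sfClass L N ε` at level `j+2` with datum `V`, `Regular d L N b g (j+2) U_B`, `0 ≤ b < ε`,
`LevelSmall d L (j+1) (ε∕(L^{j+2})²)`, `N, L ≥ 1`; `a := b∕(L^{j+2})²`.  HYPOTHESES: the curl bounds `hR3b` (`k₁, k₂`) and `hR3bL1`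
(`k₄`) of `spreadLift L U_B φ'` for `(N·L^{j+1})`-periodic data `φ'` (discharged in §4 by leaf-01-g4's `NE3SpreadLiftCurl`).  THEN for every
set `T` of skew `(N·L^{j+1})`-periodic directions tangent to run A's fibre at `W = cavg L U_B`:
`CurlPairedResidual L (j+1) W T r (periodBox (N·L^{j+1}))`, `r = L^{4−d}·wallConst·[√(g·N^d·(L^{j+2})^d∕(L^{j+2})^6)·(k₁ + c₂·a·L^{j+1})
+ a²·(2L^{d−1} + 2k₄)·√(d·(N·L^{j+1})^d)·L^{j+1}]`, `c₂ = k₁·√(8·#Plane)·128dL² + 2k₂`. [folklore] -/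
theorem curlPairedResidual_spreadInverse [Nonempty n] {L N : ℕ} [NeZero L] [NeZero N] (hL : 1 ≤ L) (hN : 1 ≤ N) (j : ℕ)
    {ε b g : ℝ} (hb : 0 ≤ b) (hbε : b < ε) (hsmall : LevelSmall d L (j + 1) (ε / ((L : ℝ) ^ (j + 2)) ^ 2))
    {V UB : Site d → Fin d → (Matrix n n ℂ)ˣ} (hB : IsMinimiser d (sfClass d L N ε) L N (j + 2) V UB)
    (hreg : Regular d L N b g (j + 2) UB) {k₁ k₂ k₄ : ℝ} (hk₁ : 0 ≤ k₁) (hk₂ : 0 ≤ k₂) (hk₄ : 0 ≤ k₄)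
    (hR3b : ∀ φ' : Site d → Fin d → Matrix n n ℂ, IsPeriodicDir φ' ((N * L ^ (j + 1) : ℕ) : ℤ) →
      Real.sqrt (curlSq UB (spreadLift L UB φ') (periodBox (N * L ^ (j + 2))))
        ≤ k₁ * Real.sqrt (curlSq (cavg L UB) φ' (periodBox (N * L ^ (j + 1))))
          + k₂ * (b / ((L : ℝ) ^ (j + 2)) ^ 2) * Real.sqrt (dirSq φ' (periodBox (N * L ^ (j + 1)))))
    (hR3bL1 : ∀ φ' : Site d → Fin d → Matrix n n ℂ, IsPeriodicDir φ' ((N * L ^ (j + 1) : ℕ) : ℤ) →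
      curlL1 UB (spreadLift L UB φ') (periodBox (N * L ^ (j + 2))) ≤ k₄ * dirL1 φ' (periodBox (N * L ^ (j + 1))))
    {T : Set (Site d → Fin d → Matrix n n ℂ)}
    (hT : ∀ Y ∈ T, IsSkewDir Y ∧ IsPeriodicDir Y ((N * L ^ (j + 1) : ℕ) : ℤ) ∧ TangentIter L j (cavg L UB) Y) :
    CurlPairedResidual L (j + 1) (cavg L UB) T
      ((L : ℝ) ^ (4 - (d : ℤ)) * wallConst d L
          * (Real.sqrt (g * (N : ℝ) ^ d * ((L : ℝ) ^ (j + 2)) ^ d / ((L : ℝ) ^ (j + 2)) ^ 6)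
              * (k₁ + (k₁ * Real.sqrt (8 * Fintype.card (T4AveragingDeficitWall.Plane d)) * (128 * (d * (L : ℝ) ^ 2)) + 2 * k₂)
                * (b / ((L : ℝ) ^ (j + 2)) ^ 2) * (L : ℝ) ^ (j + 1))
            + (b / ((L : ℝ) ^ (j + 2)) ^ 2) ^ 2 * (2 * (L : ℝ) ^ (d - 1) + 2 * k₄)
              * Real.sqrt (d * ((N * L ^ (j + 1) : ℕ) : ℝ) ^ d) * (L : ℝ) ^ (j + 1)))
      (periodBox (N * L ^ (j + 1))) := by
  -- the one-level data at `U_B`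
  have h512 := small512_of_levelSmall (d := d) hL j hb hbε hsmall
  set a : ℝ := b / ((L : ℝ) ^ (j + 2)) ^ 2 with ha_def
  have ha : 0 ≤ a := div_nonneg hb (by positivity)
  have hV : IsUnitaryCfg UB := hreg.unitary
  have hVa : SmallField UB a := hreg.small
  set M : ℕ := N * L ^ (j + 1) with hM_def
  have hM : 1 ≤ M := Nat.mul_pos (by omega) (Nat.pow_pos (by omega))
  have hLM : L * M = N * L ^ (j + 2) := by rw [hM_def]; ring
  have hVP : IsPeriodicCfg UB ((L : ℤ) * M) := by
    have h := hreg.periodic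
    have hc : ((N * L ^ (j + 2) : ℕ) : ℤ) = (L : ℤ) * (M : ℤ) := by rw [← hLM]; push_cast; ring
    rw [← hc]; exact h
  -- the hypotheses on the torus `periodBox (L * M)`
  have hR3b' : ∀ φ' : Site d → Fin d → Matrix n n ℂ, IsPeriodicDir φ' (M : ℤ) →
      Real.sqrt (curlSq UB (spreadLift L UB φ') (periodBox (L * M)))
        ≤ k₁ * Real.sqrt (curlSq (cavg L UB) φ' (periodBox M)) + k₂ * a * Real.sqrt (dirSq φ' (periodBox M)) := by
    intro φ' hφ'
    rw [hLM]
    exact hR3b φ' hφ'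
  have hR3bL1' : ∀ φ' : Site d → Fin d → Matrix n n ℂ, IsPeriodicDir φ' (M : ℤ) →
      curlL1 UB (spreadLift L UB φ') (periodBox (L * M)) ≤ k₄ * dirL1 φ' (periodBox M) := by
    intro φ' hφ'
    rw [hLM]
    exact hR3bL1 φ' hφ'
  refine curlPairedResidual_of_exists_lift hL j hb hbε hsmall hB hreg hk₁ (by positivity) (by positivity) (by positivity)
    (fun Y hYs hYP _ => ?_) hT
  obtain ⟨hs, hP, hex, hcurl, hdirL1, hcurlL1⟩ :=
    spreadInverse_lift hL hV ha h512 hVa hM hVP hk₁ hk₂ hk₄ hR3b' hR3bL1' hYs hYP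
  refine ⟨spreadInverse hL hV ha h512 hVa Y, hs, ?_, hex, ?_, ?_, ?_⟩
  · have hc : ((L : ℤ) * (M : ℤ)) = ((N * L ^ (j + 2) : ℕ) : ℤ) := by rw [← hLM]; push_cast; ring
    rw [← hc]; exact hP
  · rw [← hLM]; exact hcurl
  · rw [← hLM]; exact hdirL1
  · rw [← hLM]; exact hcurlL1

/-! ## §4 (RES♯) in the (5b) setting WITHOUT lift hypotheses: the curl of `spreadLift` by R♯3b (`NE3SpreadLiftCurl`) -/

/-- **(RES♯) `CurlPairedResidual` BY NAME, NO LIFT HYPOTHESIS (`d ≥ 2`).**  Setting of (5b): levels `j+1`∕`j+2`, `U_B` a minimiser of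
`sfClass L N ε` at level `j+2` with datum `V`, `Regular d L N b g (j+2) U_B`, `0 ≤ b < ε`, `LevelSmall d L (j+1) (ε∕(L^{j+2})²)`,
`N, L ≥ 1`; `a := b∕(L^{j+2})²`.  For every set `T` of skew `(N·L^{j+1})`-periodic directions tangent to run A's fibre at
`W = cavg L U_B`: `CurlPairedResidual L (j+1) W T r (periodBox (N·L^{j+1}))` with the `r` of `curlPairedResidual_spreadInverse` at
leaf-01-g4's R♯3b constants `k₁ = √(L^{d−2})`, `k₂ = 2048(d+4)²L²√(d·L^d)` (`NE3SpreadLiftCurl.sqrt_curlSq_spreadLift_le`) and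
`k₄ = 8dL^d` (`NE3SpreadLiftCurl.curlL1_spreadLift_le`).  (RES♯) for the block average of the run-B minimiser is thereby a KERNEL
THEOREM of the tree at every pair of consecutive levels; its USE (T-E_w♯: two-sided energy-norm rate) is not in this file. [folklore] -/
theorem curlPairedResidual_regular [Nonempty n] (hd : 2 ≤ d) {L N : ℕ} [NeZero L] [NeZero N] (hL : 1 ≤ L) (hN : 1 ≤ N) (j : ℕ)
    {ε b g : ℝ} (hb : 0 ≤ b) (hbε : b < ε) (hsmall : LevelSmall d L (j + 1) (ε / ((L : ℝ) ^ (j + 2)) ^ 2))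
    {V UB : Site d → Fin d → (Matrix n n ℂ)ˣ} (hB : IsMinimiser d (sfClass d L N ε) L N (j + 2) V UB)
    (hreg : Regular d L N b g (j + 2) UB) {T : Set (Site d → Fin d → Matrix n n ℂ)}
    (hT : ∀ Y ∈ T, IsSkewDir Y ∧ IsPeriodicDir Y ((N * L ^ (j + 1) : ℕ) : ℤ) ∧ TangentIter L j (cavg L UB) Y) :
    CurlPairedResidual L (j + 1) (cavg L UB) T
      ((L : ℝ) ^ (4 - (d : ℤ)) * wallConst d L
          * (Real.sqrt (g * (N : ℝ) ^ d * ((L : ℝ) ^ (j + 2)) ^ d / ((L : ℝ) ^ (j + 2)) ^ 6)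
              * (Real.sqrt ((L : ℝ) ^ (d - 2))
                + (Real.sqrt ((L : ℝ) ^ (d - 2)) * Real.sqrt (8 * Fintype.card (T4AveragingDeficitWall.Plane d))
                    * (128 * (d * (L : ℝ) ^ 2))
                  + 2 * (2048 * ((d : ℝ) + 4) ^ 2 * (L : ℝ) ^ 2 * Real.sqrt (d * (L : ℝ) ^ d)))
                * (b / ((L : ℝ) ^ (j + 2)) ^ 2) * (L : ℝ) ^ (j + 1))
            + (b / ((L : ℝ) ^ (j + 2)) ^ 2) ^ 2 * (2 * (L : ℝ) ^ (d - 1) + 2 * (8 * d * (L : ℝ) ^ d))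
              * Real.sqrt (d * ((N * L ^ (j + 1) : ℕ) : ℝ) ^ d) * (L : ℝ) ^ (j + 1)))
      (periodBox (N * L ^ (j + 1))) := by
  have h512 := small512_of_levelSmall (d := d) hL j hb hbε hsmall
  have ha : 0 ≤ b / ((L : ℝ) ^ (j + 2)) ^ 2 := div_nonneg hb (by positivity)
  have hV : IsUnitaryCfg UB := hreg.unitary
  have hVa : SmallField UB (b / ((L : ℝ) ^ (j + 2)) ^ 2) := hreg.small
  have hM : 1 ≤ N * L ^ (j + 1) := Nat.mul_pos (by omega) (Nat.pow_pos (by omega))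
  have hLM : L * (N * L ^ (j + 1)) = N * L ^ (j + 2) := by ring
  refine curlPairedResidual_spreadInverse hL hN j hb hbε hsmall hB hreg (Real.sqrt_nonneg _) (by positivity) (by positivity)
    (fun φ' hφ' => ?_) (fun φ' hφ' => ?_) hT
  · have h := sqrt_curlSq_spreadLift_le hd hL hM hV ha h512 hVa hφ'
    rw [hLM] at h
    exact h
  · have h := curlL1_spreadLift_le hd hL hM hV ha h512 hVa hφ'
    rw [hLM] at h
    exact h

end

end Summit.QuantumFields.BalabanUV.T4Continuum.NE3CurlPairedResidualSpread
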